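/-
Copyright: h21 programme. Stub-ideation companion (k = 1, GENERATION 10, HOME FAMILY 1 — RECOGNISE &
IMPORT) — NOT a route file, NOT a Theorems file.  Imports no other crux workfile (the k2-g8 vocabulary
and helper SIGNATURES are copied VERBATIM, never imported).  Elaboration target: rc 0 with `sorry`
only in the helpers explicitly marked OPEN below.
-/
import Literature.NumberTheory.EllipticCurves.ReducibleModThreeFrobeniusTrace
import Literature.NumberTheory.EllipticCurves.OpenImageMazurCharacterProofs
import Literature.NumberTheory.EllipticCurves.OpenImageMazurFrobeniusProofs
import Literature.NumberTheory.EllipticCurves.OpenImageMazurTwistProofs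
import Literature.NumberTheory.EllipticCurves.ModPImageTransvectionCriterionProofs
import Literature.NumberTheory.EllipticCurves.MultiplicativeTransvectionPrimeToVProofs
import Literature.NumberTheory.EllipticCurves.TorsionStructureProofs
import Literature.NumberTheory.GaloisRepresentations.DirichletCharacterOfGaloisCharacter
import Literature.NumberTheory.DiophantineGeometry.MinimalDiscriminant
import Mathlib.NumberTheory.Basic
import Literature.NumberTheory.EllipticCurves.TorsionFrobenius
import Literature.NumberTheory.EllipticCurves.TateCurve.NumberFieldUniformizationTwistedTateJ
import Literature.NumberTheory.EllipticCurves.TateParametrisationTorsion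
import Literature.NumberTheory.EllipticCurves.NeronOggShafarevichLocal
import Literature.NumberTheory.EllipticCurves.MultiplicativeUnipotentTorsionProofs
import Literature.NumberTheory.EllipticCurves.SerreOpenImageDeterminantProofs
import Literature.NumberTheory.EllipticCurves.MatarNekovar2019.IrreducibleOverQuadraticFieldProofs
import Literature.NumberTheory.EllipticCurves.PeriodIndexLocalTriviality
import Literature.NumberTheory.EllipticCurves.Kato2004.SemilocalDecompositionProofs
import Literature.NumberTheory.GaloisRepresentations.DecompositionGroupOfCompletion
import Literature.NumberTheory.GaloisRepresentations.IntegralGaloisActionProofs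
import Literature.NumberTheory.GaloisRepresentations.ModNCyclotomicCharacter
import Mathlib.NumberTheory.Padics.HeightOneSpectrum
import HarnessLib

/-!
# Stub-ideation k = 1, GENERATION 10 (RECOGNISE & IMPORT) for `stub_switch` of crux `FreyModularity`

Companion to `STUB-IDEAS-stub_switch-1.md` (gen 10).  The road is the k2 (gen 2–8) one:
`stub_switch ⇐ CuspForcedSource ⇐ SquareSource ∧ IntegralModel ∧ CuspMemberSource ∧ SurjThreeOfCuspData`
(joins PROVED in `STUB_IDEAS_stub_switch_2g8_Sketch.lean`).  This file DISCHARGES, sorry-free and with the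
k2-g8 signatures verbatim, the whole "R-block" of PIECE C (`SurjThreeOfCuspData`) plus B2/B3 of Piece B,
by RECOGNISING each helper as an existing tree theorem:

* R1  `helper_stable_line_of_not_irreducible`  = `exists_isogenyCharacter_of_not_hasIrreducibleModPGaloisRep`
* R3  `helper_lineChar`                         = `Mazur1978.exists_isogenyCharacter` + `Mazur1978.isOpen_ker_of_smul_eq`
* Rneg `helper_character_neg_one`               = `smul_left_injective` over `𝔽₃`
* FIN2 `helper_neg_on_line_of_add_one_sq`       = `(a+1)² = 0 ⇒ a = −1` in `𝔽₃`
* R2  `helper_lineChar_unramified`              = `Mazur1978.isogenyCharacter_eq_one_of_mem_inertia` (good) /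
        `smul_smul_sub_eq_of_mem_inertia_geomPoints` + `Mazur1978.intCast_eq_one_of_unipotent` (multiplicative)
* R5  `helper_surjective_three_of_irreducible_of_three_dvd` = Serre 1972 Prop. 15 backwards:
        `Serre1972.not_dvd_natCard_of_forall_not_le_eigenvectorStabilizer` in the frame
        `exists_frame_galoisRepTorsion_rat`
* R4  `helper_char_eq_of_cyclotomic_eq` — RE-PLANNED through the tree's DIRICHLET DICTIONARY
        (`exists_isPrimitive_dirichletCharacter_eq_dirichletGaloisCharacter`,
        `not_dvd_level_of_isPrimitive_of_forall_mem_inertia`, `unitsMap_modNCyclotomicCharacter`) and the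
        elementary LEMMA Q "a primitive quadratic Dirichlet character has conductor `∣ 8·(odd squarefree)`"
        (`helper_quadConductor_odd`, `helper_quadConductor_two`, pure `ZMod` arithmetic) — replacing the
        k2-g8 CRT plan R4b/R4c/R4d.
* B2  `helper_smul_eq_of_dvd` (torsion inclusion), B3 `helper_cyclotomic_eq_of_smul_eq`
        (= `det_eq_modNCyclotomicCharacter`, Weil pairing), R4e (= Mathlib `dvd_sub_pow_of_dvd_sub`).

The PROVED glue `surjThreeOfCuspData_of (hT2 : T2Statement) : SurjThreeOfCuspData` is k2-g8's
`surjThreeOfCuspData_of_helpers` verbatim; `T2Statement` is k2-g8's `helper_frob_addOneSq_three` as a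
`Prop` (PROVED by k1 gen 9 in `STUB_IDEAS_stub_switch_1g9_Sketch.lean`, `helper_frob_addOneSq_three'`).
Disproof honoured: `Disproof.switch_false_without_det` — `det ρ̄ = χ̄` is used in B3 and (onto) in R5.
-/

set_option linter.dupNamespace false
set_option linter.unusedVariables false

noncomputable section

open scoped NumberField
open Literature.NumberTheory.EllipticCurves Literature.NumberTheory.GaloisRepresentations
open Literature.NumberTheory.GaloisRepresentations.Serre1972
open WeierstrassCurve Field NumberField IsDedekindDomain Matrix

namespace Summit.ABC.ABC.Cruxes.FreyModularity.StubSwitchK1G10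

/-! ## §0 Small algebra -/

/-- `(ℤ/3)ˣ` has exponent `2` (PROVED, `decide`; k2-g8 verbatim). -/
theorem units_zmod3_mul_self (x : (ZMod 3)ˣ) : x * x = 1 := by
  revert x; decide

theorem units_zmod3_cases (u : (ZMod 3)ˣ) : u = 1 ∨ u = -1 := by
  revert u; decide

theorem units_zmod3_neg_one_ne_one : (-1 : (ZMod 3)ˣ) ≠ 1 := by decide

/-- The sign embedding `(ℤ/3)ˣ = {±1} ↪ ℂˣ` (used to read a `(ℤ/3)ˣ`-valued Galois character as a
Dirichlet character through the tree's dictionary). -/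
def unitsSign : (ZMod 3)ˣ →* ℂˣ where
  toFun u := if u = 1 then 1 else -1
  map_one' := if_pos rfl
  map_mul' u v := by
    rcases units_zmod3_cases u with rfl | rfl <;> rcases units_zmod3_cases v with rfl | rfl
    · rw [one_mul, if_pos rfl, one_mul]
    · rw [one_mul, if_neg units_zmod3_neg_one_ne_one, if_pos rfl, one_mul]
    · rw [mul_one, if_neg units_zmod3_neg_one_ne_one, if_pos rfl, mul_one]
    · rw [units_zmod3_mul_self, if_pos rfl, if_neg units_zmod3_neg_one_ne_one, neg_mul_neg, one_mul]

theorem unitsSign_apply (u : (ZMod 3)ˣ) : unitsSign u = if u = 1 then 1 else -1 := rfl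

theorem unitsSign_eq_one_iff (u : (ZMod 3)ˣ) : unitsSign u = 1 ↔ u = 1 := by
  rcases units_zmod3_cases u with rfl | rfl
  · exact ⟨fun _ ↦ rfl, fun _ ↦ map_one _⟩
  · refine ⟨fun h ↦ ?_, fun h ↦ absurd h units_zmod3_neg_one_ne_one⟩
    rw [unitsSign_apply, if_neg units_zmod3_neg_one_ne_one] at h
    have h' := congrArg Units.val h
    rw [Units.val_neg, Units.val_one] at h'
    norm_num at h'

theorem unitsSign_injective : Function.Injective unitsSign :=
  (injective_iff_map_eq_one unitsSign).mpr fun u hu ↦ (unitsSign_eq_one_iff u).mp hu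

/-- `c • x = c.val • x` for `c : ℤ/n`. -/
theorem zmod_smul_eq_val_nsmul {n : ℕ} [NeZero n] {M : Type*} [AddCommGroup M] [Module (ZMod n) M]
    (c : ZMod n) (x : M) : c • x = c.val • x := by
  have h := Nat.cast_smul_eq_nsmul (ZMod n) c.val x
  rwa [ZMod.natCast_zmod_val] at h

/-- `(1 + D)^n = 1 + nD` when `D² = 0`. -/
theorem one_add_pow_of_mul_self_eq_zero {R : Type*} [CommRing R] (D : R) (hD : D * D = 0) (n : ℕ) :
    (1 + D) ^ n = 1 + (n : R) * D := by
  induction n with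
  | zero => simp
  | succ n ih =>
    rw [pow_succ, ih, Nat.cast_succ]
    have : (1 + (n : R) * D) * (1 + D) = 1 + ((n : R) + 1) * D + (n : R) * (D * D) := by ring
    rw [this, hD, mul_zero, add_zero]

/-- coprimality plumbing (PROVED): a place containing the prime `p` contains no `n` prime to `p`. -/
theorem helper_natCast_not_mem_of_coprime {p n : ℕ} (hcop : Nat.Coprime p n)
    {v : HeightOneSpectrum (𝓞 ℚ)} (hv : (p : 𝓞 ℚ) ∈ v.asIdeal) : (n : 𝓞 ℚ) ∉ v.asIdeal := by
  intro hn
  obtain ⟨a, b, hab⟩ := Nat.isCoprime_iff_coprime.mpr hcop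
  have hab' : (a : 𝓞 ℚ) * (p : 𝓞 ℚ) + (b : 𝓞 ℚ) * (n : 𝓞 ℚ) = 1 := by
    have h := congrArg (Int.cast : ℤ → 𝓞 ℚ) hab
    simpa using h
  apply v.isPrime.ne_top
  rw [Ideal.eq_top_iff_one, ← hab']
  exact v.asIdeal.add_mem (v.asIdeal.mul_mem_left _ hv) (v.asIdeal.mul_mem_left _ hn)

/-- k2-g8 `helper_three_not_mem` (PROVED; special case). -/
theorem helper_three_not_mem {q : ℕ} (hq : q.Prime) (hq3 : q ≠ 3) {v : HeightOneSpectrum (𝓞 ℚ)}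
    (hv : (q : 𝓞 ℚ) ∈ v.asIdeal) : ((3 : ℕ) : 𝓞 ℚ) ∉ v.asIdeal :=
  helper_natCast_not_mem_of_coprime ((Nat.coprime_primes hq Nat.prime_three).mpr hq3) hv

/-! ## §1 Piece B helpers B2, B3 (k2-g8 signatures VERBATIM) — PROVED -/

/-- **B2 (PROVED): equal actions on `W[n]` ⇒ equal on `W[d]` for `d ∣ n`** (`W[d] ≤ W[n]`,
Mathlib `Submodule.torsionBy_le_torsionBy_of_dvd`). -/
theorem helper_smul_eq_of_dvd (W : WeierstrassCurve ℚ) {d n : ℤ} (hdn : d ∣ n)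
    {φ σ : absoluteGaloisGroup ℚ} (h : ∀ P : W.geomTorsion n, φ • P = σ • P)
    (P : W.geomTorsion d) : φ • P = σ • P := by
  have hmem : (P : geomPoints W) ∈ W.geomTorsion n :=
    Submodule.torsionBy_le_torsionBy_of_dvd d n hdn P.2
  have h' := congrArg (Subtype.val : W.geomTorsion n → geomPoints W) (h ⟨P, hmem⟩)
  rw [AddSubgroup.torsionBy.coe_smul, AddSubgroup.torsionBy.coe_smul] at h'
  apply Subtype.ext
  rw [AddSubgroup.torsionBy.coe_smul, AddSubgroup.torsionBy.coe_smul]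
  exact h'

/-- **B3 (PROVED): equal actions on `W[n]` ⇒ equal `χ̄_n`** (`det ρ̄_{W,n} = χ̄_n` by the Weil pairing:
tree `det_eq_modNCyclotomicCharacter`, one frame `nonempty_geomTorsion_addEquiv_fin_two` for both). -/
theorem helper_cyclotomic_eq_of_smul_eq (W : WeierstrassCurve ℚ) [W.IsElliptic] {n : ℕ} [NeZero n]
    (hn : 2 ≤ n) {φ σ : absoluteGaloisGroup ℚ} (h : ∀ P : W.geomTorsion n, φ • P = σ • P) :
    modNCyclotomicCharacter ℚ n φ = modNCyclotomicCharacter ℚ n σ := by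
  obtain ⟨e⟩ := nonempty_geomTorsion_addEquiv_fin_two W (m := n) (NeZero.ne (n : ℚ))
  obtain ⟨f, hf⟩ : ∃ f : (Fin 2 → ZMod n) →+ (Fin 2 → ZMod n), ∀ x, f x = e (φ • e.symm x) :=
    ⟨e.toAddMonoidHom.comp ((DistribMulAction.toAddMonoidHom (W.geomTorsion n) φ).comp
      e.symm.toAddMonoidHom), fun x ↦ rfl⟩
  have hMφ : ∀ P : W.geomTorsion n,
      e (φ • P) = (LinearMap.toMatrix' (f.toZModLinearMap n)).mulVec (e P) := fun P ↦ by
    rw [LinearMap.toMatrix'_mulVec, AddMonoidHom.coe_toZModLinearMap, hf, AddEquiv.symm_apply_apply]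
  have hMσ : ∀ P : W.geomTorsion n,
      e (σ • P) = (LinearMap.toMatrix' (f.toZModLinearMap n)).mulVec (e P) := fun P ↦ by
    rw [← h P]; exact hMφ P
  have h1 := det_eq_modNCyclotomicCharacter W n hn e φ _ hMφ
  have h2 := det_eq_modNCyclotomicCharacter W n hn e σ _ hMσ
  exact Units.ext (h1.symm.trans h2)

/-- **R4e (PROVED; = Mathlib `dvd_sub_pow_of_dvd_sub`): `a ≡ 1 (mod p)` ⇒ `a^{p^k} ≡ 1 (mod p^{k+1})`.** -/
theorem helper_pow_prime_pow_congr_one {p : ℕ} (hp : p.Prime) (k : ℕ) {a : ℤ}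
    (ha : a ≡ 1 [ZMOD p]) : a ^ p ^ k ≡ 1 [ZMOD (p : ℤ) ^ (k + 1)] := by
  have h := dvd_sub_pow_of_dvd_sub (Int.ModEq.dvd ha.symm) k
  rw [one_pow] at h
  exact (Int.modEq_iff_dvd.mpr h).symm

/-! ## §2 Piece C: the R-block (k2-g8 signatures VERBATIM) — PROVED -/

/-- **FIN2 (PROVED): `(φ+1)² = 0` on `E[3]` ⇒ `φ = −1` on every `φ`-stable line.** -/
theorem helper_neg_on_line_of_add_one_sq (E : WeierstrassCurve ℚ) [E.IsElliptic]
    {φ : absoluteGaloisGroup ℚ} (hφ : ∀ Q : E.geomTorsion 3, φ • (φ • Q + Q) + (φ • Q + Q) = 0)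
    {P : E.geomTorsion 3} (hP0 : P ≠ 0) (hst : φ • P ∈ AddSubgroup.zmultiples P) :
    φ • P = -P := by
  haveI : Fact (Nat.Prime 3) := ⟨Nat.prime_three⟩
  letI : Module (ZMod 3) (E.geomTorsion 3) := AddSubgroup.torsionBy.zmodModule (n := 3)
  obtain ⟨k, hk⟩ := AddSubgroup.mem_zmultiples_iff.mp hst
  have haP : φ • P = ((k : ZMod 3)) • P := by rw [← hk, Int.cast_smul_eq_zsmul]
  have hlin : ∀ (c : ZMod 3) (S : E.geomTorsion 3), φ • (c • S) = c • (φ • S) := fun c S ↦ by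
    rw [← ZMod.natCast_zmod_val c, Nat.cast_smul_eq_nsmul, Nat.cast_smul_eq_nsmul]
    exact map_nsmul (DistribMulAction.toAddMonoidHom (E.geomTorsion 3) φ) c.val S
  have h1 : φ • P + P = ((k : ZMod 3) + 1) • P := by rw [haP, add_smul, one_smul]
  have h2 : (((k : ZMod 3) + 1) * ((k : ZMod 3) + 1)) • P = 0 := by
    have h := hφ P
    rw [h1, hlin, haP, smul_smul, ← add_smul] at h
    have : ((k : ZMod 3) + 1) * (k : ZMod 3) + ((k : ZMod 3) + 1) =
        ((k : ZMod 3) + 1) * ((k : ZMod 3) + 1) := by ring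
    rwa [this] at h
  have hinj := smul_left_injective (ZMod 3) hP0
  have h3 : ((k : ZMod 3) + 1) * ((k : ZMod 3) + 1) = 0 :=
    hinj (show (((k : ZMod 3) + 1) * ((k : ZMod 3) + 1)) • P = (0 : ZMod 3) • P by
      rw [zero_smul]; exact h2)
  have h4 : (k : ZMod 3) = -1 := eq_neg_of_add_eq_zero_left (mul_self_eq_zero.mp h3)
  rw [haP, h4, neg_one_smul]

/-- **R1 (PROVED): reducible ⇒ a `Γ_ℚ`-stable line** (tree
`exists_isogenyCharacter_of_not_hasIrreducibleModPGaloisRep`, Mazur 1978 §5). -/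
theorem helper_stable_line_of_not_irreducible (E : WeierstrassCurve ℚ) [E.IsElliptic]
    (h : ¬ E.HasIrreducibleModPGaloisRep 3) :
    ∃ P : E.geomTorsion 3, P ≠ 0 ∧
      ∀ σ : absoluteGaloisGroup ℚ, σ • P ∈ AddSubgroup.zmultiples P := by
  haveI : Fact (Nat.Prime 3) := ⟨Nat.prime_three⟩
  haveI : NeZero ((3 : ℕ) : ℚ) := ⟨by norm_num⟩
  obtain ⟨P, r, hP0, hr⟩ := exists_isogenyCharacter_of_not_hasIrreducibleModPGaloisRep E 3 h
  refine ⟨P, hP0, fun σ ↦ ?_⟩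
  rw [hr σ]
  exact AddSubgroup.nsmul_mem _ (AddSubgroup.mem_zmultiples P) _

/-- **R3 (PROVED): the character of a stable line, with open kernel** (tree
`Mazur1978.exists_isogenyCharacter`, `Mazur1978.isOpen_ker_of_smul_eq`). -/
theorem helper_lineChar (E : WeierstrassCurve ℚ) [E.IsElliptic] {P : E.geomTorsion 3} (hP0 : P ≠ 0)
    (hst : ∀ σ : absoluteGaloisGroup ℚ, σ • P ∈ AddSubgroup.zmultiples P) :
    ∃ r : absoluteGaloisGroup ℚ →* (ZMod 3)ˣ,
      IsOpen ((r.ker : Subgroup (absoluteGaloisGroup ℚ)) : Set (absoluteGaloisGroup ℚ)) ∧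
      ∀ σ : absoluteGaloisGroup ℚ, σ • P = ((r σ : (ZMod 3)ˣ) : ZMod 3).val • P := by
  haveI : Fact (Nat.Prime 3) := ⟨Nat.prime_three⟩
  obtain ⟨r, hr⟩ := Mazur1978.exists_isogenyCharacter E 3 hP0 hst
  exact ⟨r, Mazur1978.isOpen_ker_of_smul_eq E 3 hP0 hr, hr⟩

/-- **Rneg (PROVED): a line character takes the value `−1` at `φ` when `φ • P = −P`.** -/
theorem helper_character_neg_one (E : WeierstrassCurve ℚ) [E.IsElliptic]
    {P : E.geomTorsion 3} (hP0 : P ≠ 0) {r : absoluteGaloisGroup ℚ →* (ZMod 3)ˣ}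
    (hr : ∀ σ : absoluteGaloisGroup ℚ, σ • P = ((r σ : (ZMod 3)ˣ) : ZMod 3).val • P)
    {φ : absoluteGaloisGroup ℚ} (hφ : φ • P = -P) : r φ = -1 := by
  haveI : Fact (Nat.Prime 3) := ⟨Nat.prime_three⟩
  letI : Module (ZMod 3) (E.geomTorsion 3) := AddSubgroup.torsionBy.zmodModule (n := 3)
  have hinj := smul_left_injective (ZMod 3) hP0
  have h1 : ((r φ : (ZMod 3)ˣ) : ZMod 3) • P = ((-1 : (ZMod 3)ˣ) : ZMod 3) • P := by
    rw [zmod_smul_eq_val_nsmul, ← hr φ, hφ, Units.val_neg, Units.val_one, neg_one_smul]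
  exact Units.ext (hinj h1)

/-- **R2 (PROVED): a line character is unramified at every semistable `w ∤ 3`.**  Good reduction:
`Mazur1978.isogenyCharacter_eq_one_of_mem_inertia`; multiplicative: inertia acts unipotently on `E[3]`
(`smul_smul_sub_eq_of_mem_inertia_geomPoints`), so its eigenvalue on the line is `1`
(`Mazur1978.intCast_eq_one_of_unipotent`) — the body of the tree's
`isogenyCharacter_eq_one_of_mem_inertia_of_isSemistable`, localised to one place. -/
theorem helper_lineChar_unramified (E : WeierstrassCurve ℚ) [E.IsElliptic] {P : E.geomTorsion 3}
    (hP0 : P ≠ 0) {r : absoluteGaloisGroup ℚ →* (ZMod 3)ˣ}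
    (hr : ∀ σ : absoluteGaloisGroup ℚ, σ • P = ((r σ : (ZMod 3)ˣ) : ZMod 3).val • P)
    {w : HeightOneSpectrum (𝓞 ℚ)} (h3w : ((3 : ℕ) : 𝓞 ℚ) ∉ w.asIdeal) (hw : E.IsSemistableAt w)
    {𝔓 : Ideal (absIntegers (𝓞 ℚ) ℚ)} (h𝔓 : 𝔓 ∈ w.primesAbove)
    {σ : absoluteGaloisGroup ℚ} (hσ : σ ∈ 𝔓.inertia (absoluteGaloisGroup ℚ)) : r σ = 1 := by
  haveI : Fact (Nat.Prime 3) := ⟨Nat.prime_three⟩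
  rcases hw with hgood | hmult
  · exact Mazur1978.isogenyCharacter_eq_one_of_mem_inertia E 3 hP0 hr hgood h3w h𝔓 hσ
  · have hP0' : (P : geomPoints E) ≠ 0 := fun h ↦ hP0 (Subtype.ext h)
    have h3P : (3 : ℤ) • (P : geomPoints E) = 0 := (Submodule.mem_torsionBy_iff _ _).mp P.2
    have hpP : (3 : ℕ) • (P : geomPoints E) = 0 := by rw [← natCast_zsmul]; exact h3P
    have hpP' : 3 ^ 1 • (P : geomPoints E) = 0 := by rwa [pow_one]
    have hunip :=
      E.smul_smul_sub_eq_of_mem_inertia_geomPoints hmult Nat.prime_three h3w le_rfl h𝔓 hσ hpP'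
    have hs : DistribSMul.toAddMonoidHom (geomPoints E) σ (P : geomPoints E) =
        ((((r σ : (ZMod 3)ˣ) : ZMod 3).val : ℤ)) • (P : geomPoints E) := by
      rw [DistribSMul.toAddMonoidHom_apply, natCast_zsmul]
      have := congrArg (Subtype.val : E.geomTorsion 3 → geomPoints E) (hr σ)
      simpa only [AddSubgroup.torsionBy.coe_smul, AddSubmonoidClass.coe_nsmul] using this
    have h1 := Mazur1978.intCast_eq_one_of_unipotent Nat.prime_three hP0' hpP
      (DistribSMul.toAddMonoidHom (geomPoints E) σ) hs
      (by simpa only [DistribSMul.toAddMonoidHom_apply] using hunip)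
    rw [Int.cast_natCast, ZMod.natCast_zmod_val] at h1
    exact Units.ext h1

/-- **R5 (PROVED): irreducible and `3 ∣ #ρ̄_{E,3}(Γ_ℚ)` ⇒ onto `GL₂(𝔽₃)`** — Serre 1972 Prop. 15 read
backwards (`Serre1972.not_dvd_natCard_of_forall_not_le_eigenvectorStabilizer`) in the frame
`exists_frame_galoisRepTorsion_rat` (`det = χ̄₃` onto: `exists_mem_map_range_det_eq`; no Borel:
`not_le_eigenvectorStabilizer_of_hasIrreducibleModPGaloisRep`). -/
theorem helper_surjective_three_of_irreducible_of_three_dvd (E : WeierstrassCurve ℚ) [E.IsElliptic]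
    (hirr : E.HasIrreducibleModPGaloisRep 3)
    (h3 : 3 ∣ Nat.card (galoisRepTorsion E ((3 : ℕ) : ℤ)).range) :
    E.HasSurjectiveModNGaloisRep ((3 : ℕ) : ℤ) := by
  haveI : Fact (Nat.Prime 3) := ⟨Nat.prime_three⟩
  by_contra hns
  obtain ⟨e, Φ, he, -, -, -, -⟩ := exists_frame_galoisRepTorsion_rat E 3
  set G : Subgroup (GL (Fin 2) (ZMod 3)) := (galoisRepTorsion E 3).range.map Φ.toMonoidHom with hG
  have hGtop : G ≠ ⊤ := fun h ↦ hns ((map_range_galoisRepTorsion_eq_top_iff E 3 Φ).mp h)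
  have hdetG : ∀ u : (ZMod 3)ˣ, ∃ g ∈ G, Matrix.GeneralLinearGroup.det g = u :=
    exists_mem_map_range_det_eq E 3 Φ e he
  have hirrG : ∀ (v : Fin 2 → ZMod 3) (hv : v ≠ 0), ¬ G ≤ eigenvectorStabilizer v hv :=
    fun v hv ↦ not_le_eigenvectorStabilizer_of_hasIrreducibleModPGaloisRep E 3 Φ e he hirr hv
  have hcard : Nat.card G = Nat.card (galoisRepTorsion E ((3 : ℕ) : ℤ)).range :=
    Subgroup.card_map_of_injective Φ.injective
  exact not_dvd_natCard_of_forall_not_le_eigenvectorStabilizer G hdetG hGtop hirrG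
    (by rw [hcard]; exact h3)

/-! ## §3 R4 RE-PLANNED: the Dirichlet dictionary + LEMMA Q -/

/-- **Kernel of `(ℤ/N)ˣ → (ℤ/d)ˣ`**: its elements are `1 + d·q`. -/
theorem helper_ker_unitsMap_coe {N d : ℕ} [NeZero N] (hdN : d ∣ N) (hd1 : 1 < d) {u : (ZMod N)ˣ}
    (hu : ZMod.unitsMap hdN u = 1) :
    ∃ q : ℕ, (u : ZMod N) = 1 + (d : ZMod N) * (q : ZMod N) := by
  haveI : NeZero d := ⟨by omega⟩
  obtain ⟨a, ha⟩ : ∃ a : ℕ, (u : ZMod N) = a := ⟨(u : ZMod N).val, (ZMod.natCast_zmod_val _).symm⟩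
  have h1 : (ZMod.castHom hdN (ZMod d)) (u : ZMod N) = 1 := by
    have := congrArg Units.val hu
    rwa [ZMod.unitsMap_def, Units.coe_map, MonoidHom.coe_coe, Units.val_one] at this
  rw [ha, map_natCast] at h1
  have h3 : a % d = 1 := by
    have := (ZMod.natCast_eq_natCast_iff' a 1 d).mp (by rw [Nat.cast_one]; exact h1)
    rw [this]; exact Nat.mod_eq_of_lt hd1
  refine ⟨a / d, ?_⟩
  rw [ha]
  conv_lhs => rw [← Nat.div_add_mod a d, h3]
  push_cast
  ring

/-- **LEMMA Q, odd part (PROVED): a primitive quadratic Dirichlet character has level prime to `p²`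
for every odd prime `p`.**  (`d = N/p`; `ker((ℤ/N)ˣ → (ℤ/d)ˣ) = {1 + dq}` has exponent `p` because
`p ∣ d`; a value that is both a square root and a `p`-th root of `1` is `1`; so `χ` factors through
`d < N`.) -/
theorem helper_quadConductor_odd {N : ℕ} [NeZero N] (χ : DirichletCharacter ℂ N)
    (hχ : χ.IsPrimitive) (h2 : ∀ a : (ZMod N)ˣ, χ (a : ZMod N) ^ 2 = 1) {p : ℕ} (hp : p.Prime)
    (hp2 : p ≠ 2) : ¬ p ^ 2 ∣ N := by
  rintro ⟨e, he⟩
  obtain ⟨d, hd⟩ : ∃ d, d = p * e := ⟨_, rfl⟩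
  have hNd : N = p * d := by rw [he, hd, pow_two, mul_assoc]
  have hdN : d ∣ N := ⟨p, by rw [hNd, mul_comm]⟩
  have he0 : 0 < e := Nat.pos_of_ne_zero (by rintro rfl; exact NeZero.ne N (by rw [he, mul_zero]))
  have hd0 : 0 < d := by rw [hd]; exact Nat.mul_pos hp.pos he0
  have hd1 : 1 < d := by
    rw [hd]; exact lt_of_lt_of_le hp.one_lt (Nat.le_mul_of_pos_right p he0)
  have hdlt : d < N := by rw [hNd]; nlinarith [hp.one_lt, hd0]
  have hdd : (d : ZMod N) * (d : ZMod N) = 0 := by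
    rw [← Nat.cast_mul, CharP.cast_eq_zero_iff (ZMod N) N]
    exact ⟨e, by rw [hNd, hd]; ring⟩
  have hpd : (p : ZMod N) * (d : ZMod N) = 0 := by
    rw [← Nat.cast_mul, ← hNd, ZMod.natCast_self]
  have hfac : χ.FactorsThrough d := by
    rw [DirichletCharacter.factorsThrough_iff_ker_unitsMap hdN]
    intro u hu
    rw [MonoidHom.mem_ker] at hu ⊢
    obtain ⟨q, hq⟩ := helper_ker_unitsMap_coe hdN hd1 hu
    have hD : (d : ZMod N) * (q : ZMod N) * ((d : ZMod N) * (q : ZMod N)) = 0 := by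
      have : (d : ZMod N) * (q : ZMod N) * ((d : ZMod N) * (q : ZMod N)) =
          (d : ZMod N) * (d : ZMod N) * ((q : ZMod N) * q) := by ring
      rw [this, hdd, zero_mul]
    have hup : u ^ p = 1 := by
      apply Units.ext
      rw [Units.val_pow_eq_pow_val, Units.val_one, hq,
        one_add_pow_of_mul_self_eq_zero _ hD p, ← mul_assoc, hpd, zero_mul, add_zero]
    have hu2 : χ.toUnitHom u ^ 2 = 1 := by
      apply Units.ext
      rw [Units.val_pow_eq_pow_val, MulChar.coe_toUnitHom, Units.val_one]
      exact h2 u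
    have hupχ : χ.toUnitHom u ^ p = 1 := by rw [← map_pow, hup, map_one]
    have hg := pow_gcd_eq_one.mpr ⟨hupχ, hu2⟩
    have hg1 : p.gcd 2 = 1 := (Nat.coprime_primes hp Nat.prime_two).mpr hp2
    rwa [hg1, pow_one] at hg
  have hcond := DirichletCharacter.conductor_dvd_of_mem_conductorSet χ hfac
  rw [hχ] at hcond
  exact absurd (Nat.le_of_dvd hd0 hcond) (not_le.mpr hdlt)

/-- **LEMMA Q, even part (PROVED): a primitive quadratic Dirichlet character has level prime to `16`.**
(`N = 16e`, `d = 8e`: the kernel `{1, 1 + d}` of `(ℤ/N)ˣ → (ℤ/d)ˣ` consists of squares, since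
`1 + d = (1 + 4e)²` and `(1 + 4e)(1 − 4e) = 1` in `ℤ/N`.) -/
theorem helper_quadConductor_two {N : ℕ} [NeZero N] (χ : DirichletCharacter ℂ N)
    (hχ : χ.IsPrimitive) (h2 : ∀ a : (ZMod N)ˣ, χ (a : ZMod N) ^ 2 = 1) : ¬ 16 ∣ N := by
  rintro ⟨e, he⟩
  have hNd : N = 2 * (8 * e) := by rw [he]; ring
  have hdN : 8 * e ∣ N := ⟨2, by rw [hNd, mul_comm]⟩
  have he0 : 0 < e := Nat.pos_of_ne_zero (by rintro rfl; exact NeZero.ne N (by rw [he, mul_zero]))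
  have hd0 : 0 < 8 * e := by omega
  have hd1 : 1 < 8 * e := by omega
  have hdlt : 8 * e < N := by rw [hNd]; omega
  have h16 : (16 : ZMod N) * (e : ZMod N) = 0 := by
    have h : ((16 * e : ℕ) : ZMod N) = 0 := by rw [← he]; exact ZMod.natCast_self N
    push_cast at h
    exact h
  have hw1 : (1 + 4 * (e : ZMod N)) * (1 - 4 * (e : ZMod N)) = 1 := by
    have : (1 + 4 * (e : ZMod N)) * (1 - 4 * (e : ZMod N)) =
        1 - (e : ZMod N) * (16 * (e : ZMod N)) := by ring
    rw [this, h16, mul_zero, sub_zero]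
  have hw2 : (1 - 4 * (e : ZMod N)) * (1 + 4 * (e : ZMod N)) = 1 := by rw [mul_comm]; exact hw1
  obtain ⟨w, hw⟩ : ∃ w : (ZMod N)ˣ, (w : ZMod N) = 1 + 4 * (e : ZMod N) :=
    ⟨⟨1 + 4 * (e : ZMod N), 1 - 4 * (e : ZMod N), hw1, hw2⟩, rfl⟩
  have hwsq : ((w ^ 2 : (ZMod N)ˣ) : ZMod N) = 1 + 8 * (e : ZMod N) := by
    rw [Units.val_pow_eq_pow_val, hw]
    have : (1 + 4 * (e : ZMod N)) ^ 2 = 1 + 8 * (e : ZMod N) + (e : ZMod N) * (16 * (e : ZMod N)) := by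
      ring
    rw [this, h16, mul_zero, add_zero]
  have hfac : χ.FactorsThrough (8 * e) := by
    rw [DirichletCharacter.factorsThrough_iff_ker_unitsMap hdN]
    intro u hu
    rw [MonoidHom.mem_ker] at hu ⊢
    obtain ⟨q, hq⟩ := helper_ker_unitsMap_coe hdN hd1 hu
    rcases Nat.even_or_odd q with ⟨r, hr⟩ | ⟨r, hr⟩
    · have hu1 : u = 1 := by
        apply Units.ext
        rw [hq, hr, Units.val_one]
        have : ((8 * e : ℕ) : ZMod N) * ((r + r : ℕ) : ZMod N) =
            (r : ZMod N) * (16 * (e : ZMod N)) := by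
          push_cast; ring
        rw [this, h16, mul_zero, add_zero]
      rw [hu1, map_one]
    · have huw : u = w ^ 2 := by
        apply Units.ext
        rw [hwsq, hq, hr]
        have : ((8 * e : ℕ) : ZMod N) * ((2 * r + 1 : ℕ) : ZMod N) =
            (r : ZMod N) * (16 * (e : ZMod N)) + 8 * (e : ZMod N) := by
          push_cast; ring
        rw [this, h16, mul_zero, zero_add]
      rw [huw, map_pow]
      apply Units.ext
      rw [Units.val_pow_eq_pow_val, MulChar.coe_toUnitHom, Units.val_one]
      exact h2 w
  have hcond := DirichletCharacter.conductor_dvd_of_mem_conductorSet χ hfac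
  rw [hχ] at hcond
  exact absurd (Nat.le_of_dvd hd0 hcond) (not_le.mpr hdlt)

/-- **Local-to-global divisibility (PROVED)**: `N ∣ M` as soon as every prime of `N` divides `M`,
`N` is odd-squarefree with `16 ∤ N`, and `8 ∣ M`. -/
theorem helper_dvd_of_local {N M : ℕ} (h8 : 8 ∣ M)
    (hpr : ∀ p : ℕ, p.Prime → p ∣ N → p ∣ M)
    (hodd : ∀ p : ℕ, p.Prime → p ≠ 2 → ¬ p ^ 2 ∣ N) (h16 : ¬ 16 ∣ N) : N ∣ M := by
  rw [Nat.dvd_iff_prime_pow_dvd_dvd]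
  intro p k hp hpk
  rcases k with _ | k
  · rw [pow_zero]; exact one_dvd M
  by_cases hp2 : p = 2
  · subst hp2
    have hk : k + 1 ≤ 3 := by
      by_contra hk
      have h4 : 2 ^ 4 ∣ 2 ^ (k + 1) := pow_dvd_pow 2 (by omega)
      exact h16 (by have := h4.trans hpk; norm_num at this; exact this)
    have h8' : 2 ^ 3 ∣ M := by norm_num; exact h8
    exact (pow_dvd_pow 2 hk).trans h8'
  · have hk : k = 0 := by
      by_contra hk
      have hsq : p ^ 2 ∣ p ^ (k + 1) := pow_dvd_pow p (by omega)
      exact hodd p hp hp2 (hsq.trans hpk)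
    subst hk
    rw [zero_add, pow_one] at hpk ⊢
    exact hpr p hp hpk

/-- **R4 (PROVED; k2-g8 signature VERBATIM): a character `Γ_ℚ → (ℤ/3)ˣ` with open kernel, unramified
at every `w ∤ m` (`8 ∣ m`), takes equal values on elements with equal `χ̄_m`.**  Proof: read `ψ` in `ℂˣ`
(`unitsSign`), take the primitive Dirichlet character `χ` of level `N` with `ψ = χ ∘ χ̄_N`
(`exists_isPrimitive_dirichletCharacter_eq_dirichletGaloisCharacter`, Kronecker–Weber inside); every
prime `p ∣ N` divides `m` (else `ψ` is unramified at `p` and `not_dvd_level_of_isPrimitive_of_forall_mem_inertia`);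
`χ² = 1` (`χ̄_N` onto), so LEMMA Q bounds the exponents and `N ∣ m` (`helper_dvd_of_local`); finally
`χ̄_m(σ) = χ̄_m(σ') ⇒ χ̄_N(σ) = χ̄_N(σ')` (`unitsMap_modNCyclotomicCharacter`). -/
theorem helper_char_eq_of_cyclotomic_eq {m : ℕ} [NeZero m] (h8 : 8 ∣ m)
    (ψ : absoluteGaloisGroup ℚ →* (ZMod 3)ˣ)
    (hker : IsOpen ((ψ.ker : Subgroup (absoluteGaloisGroup ℚ)) : Set (absoluteGaloisGroup ℚ)))
    (hunr : ∀ (w : HeightOneSpectrum (𝓞 ℚ)), (m : 𝓞 ℚ) ∉ w.asIdeal →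
      ∀ 𝔓 ∈ w.primesAbove, ∀ σ ∈ 𝔓.inertia (absoluteGaloisGroup ℚ), ψ σ = 1)
    {σ σ' : absoluteGaloisGroup ℚ}
    (hσ : modNCyclotomicCharacter ℚ m σ = modNCyclotomicCharacter ℚ m σ') : ψ σ = ψ σ' := by
  -- (1) `ψ` as a complex character with the same (open) kernel
  have hkerEq : (unitsSign.comp ψ).ker = ψ.ker := by
    ext τ
    rw [MonoidHom.mem_ker, MonoidHom.mem_ker, MonoidHom.comp_apply, unitsSign_eq_one_iff]
  have hkerC : IsOpen (((unitsSign.comp ψ).ker : Subgroup (absoluteGaloisGroup ℚ)) :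
      Set (absoluteGaloisGroup ℚ)) := by
    rw [hkerEq]; exact hker
  -- (2) the primitive Dirichlet character of `ψ`
  obtain ⟨N, hN, χ, hprim, hχ⟩ :=
    exists_isPrimitive_dirichletCharacter_eq_dirichletGaloisCharacter (unitsSign.comp ψ) hkerC
  haveI := hN
  -- (3) `χ` is quadratic
  have h2 : ∀ a : (ZMod N)ˣ, χ (a : ZMod N) ^ 2 = 1 := by
    intro a
    obtain ⟨τ, rfl⟩ := modNCyclotomicCharacter_rat_surjective N a
    rw [← coe_dirichletGaloisCharacter_apply, ← hχ τ, ← Units.val_pow_eq_pow_val,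
      MonoidHom.comp_apply, ← map_pow, pow_two, units_zmod3_mul_self, map_one, Units.val_one]
  -- (4) every prime of `N` divides `m`
  have hprimes : ∀ p : ℕ, p.Prime → p ∣ N → p ∣ m := by
    intro p hp hpN
    by_contra hpm
    set v : HeightOneSpectrum (𝓞 ℚ) := Rat.HeightOneSpectrum.primesEquiv.symm ⟨p, hp⟩ with hvdef
    have hgen : Rat.HeightOneSpectrum.natGenerator v = p := by
      change ((Rat.HeightOneSpectrum.primesEquiv v : Nat.Primes) : ℕ) = p
      rw [hvdef, Equiv.apply_symm_apply]
    have hv : (p : 𝓞 ℚ) ∈ v.asIdeal := by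
      have h := Mazur1978.natCast_natGenerator_mem_asIdeal v
      rwa [hgen] at h
    have hmv : (m : 𝓞 ℚ) ∉ v.asIdeal :=
      helper_natCast_not_mem_of_coprime ((Nat.Prime.coprime_iff_not_dvd hp).mpr hpm) hv
    obtain ⟨𝔓, h𝔓⟩ := v.primesAbove_nonempty
    have hψI : ∀ τ ∈ 𝔓.inertia (absoluteGaloisGroup ℚ),
        ((dirichletGaloisCharacter ℚ χ τ : ℂˣ) : ℂ) = 1 := by
      intro τ hτ
      rw [← hχ τ, MonoidHom.comp_apply, hunr v hmv 𝔓 h𝔓 τ hτ, map_one, Units.val_one]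
    exact not_dvd_level_of_isPrimitive_of_forall_mem_inertia hprim hp hv h𝔓 hψI hpN
  -- (5) `N ∣ m`
  have hNm : N ∣ m := helper_dvd_of_local h8 hprimes
    (fun p hp hp2 ↦ helper_quadConductor_odd χ hprim h2 hp hp2) (helper_quadConductor_two χ hprim h2)
  -- (6) conclude
  have hN' : modNCyclotomicCharacter ℚ N σ = modNCyclotomicCharacter ℚ N σ' := by
    rw [← unitsMap_modNCyclotomicCharacter ℚ hNm σ, ← unitsMap_modNCyclotomicCharacter ℚ hNm σ', hσ]
  have hC : (unitsSign.comp ψ) σ = (unitsSign.comp ψ) σ' := by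
    apply Units.ext
    rw [hχ σ, hχ σ', coe_dirichletGaloisCharacter_apply, coe_dirichletGaloisCharacter_apply, hN']
  rw [MonoidHom.comp_apply, MonoidHom.comp_apply] at hC
  exact unitsSign_injective hC

/-! ## §4 Piece C (k2-g8 VERBATIM) and its PROVED glue from the helpers above -/

/-- **PIECE C (k2-g8 verbatim).** -/
def SurjThreeOfCuspData : Prop :=
  ∀ (E : WeierstrassCurve ℚ) [E.IsElliptic] (M : ℕ) [NeZero M] (q : ℕ) (v : HeightOneSpectrum (𝓞 ℚ))
    (𝔓 : Ideal (absIntegers (𝓞 ℚ) ℚ)) (φ τ : absoluteGaloisGroup ℚ),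
    8 ∣ M → 3 ∣ M →
    (∀ w : HeightOneSpectrum (𝓞 ℚ), (M : 𝓞 ℚ) ∉ w.asIdeal → E.IsSemistableAt w) →
    q.Prime → ¬ q ∣ M → (q : 𝓞 ℚ) ∈ v.asIdeal → 𝔓 ∈ v.primesAbove → IsArithFrobAt (𝓞 ℚ) φ 𝔓 →
    E.HasMultiplicativeReductionAt v → E.ordMinimalDiscriminant v = 5 →
    (∀ P : E.geomTorsion 5, φ • P = -P) →
    modNCyclotomicCharacter ℚ 3 φ = 1 → modNCyclotomicCharacter ℚ 5 φ = 1 →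
    modNCyclotomicCharacter ℚ M φ = modNCyclotomicCharacter ℚ M (τ * τ) →
    E.HasSurjectiveModNGaloisRep ((3 : ℕ) : ℤ)

/-- **T2 as a `Prop` (k2-g8 `helper_frob_addOneSq_three` signature; PROVED by k1 gen 9 as
`StubSwitchK1G9.helper_frob_addOneSq_three'`):** `(Frob_q + 1)² = 0` on `E[3]`. -/
def T2Statement : Prop :=
  ∀ (E : WeierstrassCurve ℚ) [E.IsElliptic] {v : HeightOneSpectrum (𝓞 ℚ)},
    E.HasMultiplicativeReductionAt v → ∀ {𝔓 : Ideal (absIntegers (𝓞 ℚ) ℚ)}, 𝔓 ∈ v.primesAbove →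
    ∀ {φ : absoluteGaloisGroup ℚ}, IsArithFrobAt (𝓞 ℚ) φ 𝔓 →
    modNCyclotomicCharacter ℚ 3 φ = 1 → modNCyclotomicCharacter ℚ 5 φ = 1 →
    (∀ P : E.geomTorsion 5, φ • P = -P) →
    ∀ Q : E.geomTorsion 3, φ • (φ • Q + Q) + (φ • Q + Q) = 0

/-- **PIECE C from T2 alone (PROVED GLUE; k2-g8 `surjThreeOfCuspData_of_helpers` verbatim, every other
helper now a theorem of this file).** -/
theorem surjThreeOfCuspData_of (hT2 : T2Statement) : SurjThreeOfCuspData := by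
  intro E _ M _ q v 𝔓 φ τ h8 h3M hss hq hqM hv h𝔓 hφ hmult hord hneg h3 h5 hM
  have hq3 : q ≠ 3 := by rintro rfl; exact hqM h3M
  have h3v : ((3 : ℕ) : 𝓞 ℚ) ∉ v.asIdeal := helper_three_not_mem hq hq3 hv
  have hdvd : 3 ∣ Nat.card (galoisRepTorsion E ((3 : ℕ) : ℤ)).range :=
    E.dvd_card_range_galoisRepTorsion_of_hasMultiplicativeReductionAt_of_not_dvd hmult
      Nat.prime_three h3v (by rw [hord]; decide)
  refine helper_surjective_three_of_irreducible_of_three_dvd E ?_ hdvd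
  by_contra hirr
  obtain ⟨P, hP0, hst⟩ := helper_stable_line_of_not_irreducible E hirr
  obtain ⟨r, hker, hr⟩ := helper_lineChar E hP0 hst
  have hφP : φ • P = -P :=
    helper_neg_on_line_of_add_one_sq E (hT2 E hmult h𝔓 hφ h3 h5 hneg) hP0 (hst φ)
  have hr1 : r φ = -1 := helper_character_neg_one E hP0 hr hφP
  have hunr : ∀ (w : HeightOneSpectrum (𝓞 ℚ)), (M : 𝓞 ℚ) ∉ w.asIdeal →
      ∀ 𝔓' ∈ w.primesAbove, ∀ σ ∈ 𝔓'.inertia (absoluteGaloisGroup ℚ), r σ = 1 := by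
    intro w hw 𝔓' h𝔓' σ hσ
    have h3w : ((3 : ℕ) : 𝓞 ℚ) ∉ w.asIdeal := fun h => hw (by
      obtain ⟨k, hk⟩ := h3M
      rw [hk, Nat.cast_mul]
      exact Ideal.mul_mem_right _ _ h)
    exact helper_lineChar_unramified E hP0 hr h3w (hss w hw) h𝔓' hσ
  have heq : r φ = r (τ * τ) := helper_char_eq_of_cyclotomic_eq h8 r hker hunr hM
  rw [map_mul, units_zmod3_mul_self] at heq
  rw [heq] at hr1
  exact absurd hr1 (by decide)

/-! ## §5 T2 DISCHARGED — k1 GEN 9 §1–§2 VERBATIM (`STUB_IDEAS_stub_switch_1g9_Sketch.lean`, lines 108–388,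
sorry-free there and here; copied, not imported, per the crux-workfile convention), then PIECE C CLOSED. -/

section K1G9Verbatim

open scoped Classical Pointwise

/-! ### (k1-g9 §1)  The eigenline re-cut of the Tate block (helpers E1–E7)

Notation: `K_v = v.adicCompletion K`, `K̄_v = AlgebraicClosure K_v`, `Ψ : K̄_vˣ → E(K̄_v)` a TWISTED Tate
parametrisation with kernel `q^ℤ` and sign `ε : Γ_{K_v} → {±1}` (`σ • Ψ(u) = ε σ • Ψ(σ u)`), as delivered by
`TateCurve.exists_twistedTateUniformisation_tateJ` with `ε σ = if σ t = t then 1 else -1`. -/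

section Local

variable {K : Type} [Field K] [NumberField K] (W : WeierstrassCurve K) (v : HeightOneSpectrum (𝓞 K))

/-- **E1 (PROVED here; pure import) — the Tate EIGENPOINT.** For a root of unity `u ∈ K̄_vˣ` of prime
order `p`, `L := Ψ(u)` is a non-zero `p`-torsion point, and every `σ ∈ Γ_{K_v}` FIXING `u` acts on `L`
by the sign `ε σ`.  (`map_ofMul_ne_zero_of_pow_eq_one`, `zsmul_map_ofMul_eq_zero_of_pow_eq_one`, `htw`.)
Replaces the "shape on ALL `p₁p₂`-torsion" of k2-g8 T1: only the eigenpoint is needed downstream. -/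
theorem helper_tate_eigenpoint_local {q : v.adicCompletion K} (hq0 : q ≠ 0) (hq1 : Valued.v q < 1)
    (Ψ : Additive (AlgebraicClosure (v.adicCompletion K))ˣ →+ localPoints W (v.adicCompletion K))
    (hker : ∀ u : (AlgebraicClosure (v.adicCompletion K))ˣ, Ψ (Additive.ofMul u) = 0 ↔
      ∃ n : ℤ, (u : AlgebraicClosure (v.adicCompletion K)) =
        algebraMap (v.adicCompletion K) (AlgebraicClosure (v.adicCompletion K)) q ^ n)
    (ε : absoluteGaloisGroup (v.adicCompletion K) → ℤ)
    (htw : ∀ (σ : absoluteGaloisGroup (v.adicCompletion K))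
        (u : (AlgebraicClosure (v.adicCompletion K))ˣ),
      σ • Ψ (Additive.ofMul u) = ε σ • Ψ (Additive.ofMul (Units.map
        (Field.absoluteGaloisGroup.toAlgEquiv (v.adicCompletion K) σ :
          AlgebraicClosure (v.adicCompletion K) →* AlgebraicClosure (v.adicCompletion K)) u)))
    {p : ℕ} [Fact p.Prime] {u : (AlgebraicClosure (v.adicCompletion K))ˣ} (hup : u ^ p = 1)
    (hu1 : u ≠ 1) :
    Ψ (Additive.ofMul u) ≠ 0 ∧ (p : ℤ) • Ψ (Additive.ofMul u) = 0 ∧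
      ∀ σ : absoluteGaloisGroup (v.adicCompletion K),
        Field.absoluteGaloisGroup.toAlgEquiv (v.adicCompletion K) σ u = u →
          σ • Ψ (Additive.ofMul u) = ε σ • Ψ (Additive.ofMul u) := by
  refine ⟨map_ofMul_ne_zero_of_pow_eq_one (W := W) (v := v) hq0 hq1 Ψ hker hup hu1,
    zsmul_map_ofMul_eq_zero_of_pow_eq_one (W := W) (v := v) Ψ hup, fun σ hσ ↦ ?_⟩
  have hfix : Units.map (Field.absoluteGaloisGroup.toAlgEquiv (v.adicCompletion K) σ :
      AlgebraicClosure (v.adicCompletion K) →* AlgebraicClosure (v.adicCompletion K)) u = u :=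
    Units.ext (by simpa using hσ)
  simpa only [hfix] using htw σ u

/-- **E1′ (PROVED here) — roots of unity of `K̄` give the units `u` of E1**, fixed by every
`σ ∈ Γ_{K_v}` whose restriction fixes them in `K̄` (IMPORT 6). -/
theorem helper_unit_of_closureEmb {p : ℕ} (hp : p.Prime) {ζ : AlgebraicClosure K} (hζp : ζ ^ p = 1)
    (hζ1 : ζ ≠ 1) :
    ∃ u : (AlgebraicClosure (v.adicCompletion K))ˣ,
      (u : AlgebraicClosure (v.adicCompletion K)) = closureEmb (K := K) (v.adicCompletion K) ζ ∧
      u ^ p = 1 ∧ u ≠ 1 ∧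
      ∀ σ : absoluteGaloisGroup (v.adicCompletion K), resGal (K := K) (v.adicCompletion K) σ • ζ = ζ →
        Field.absoluteGaloisGroup.toAlgEquiv (v.adicCompletion K) σ u = u := by
  have hζu : IsUnit (closureEmb (K := K) (v.adicCompletion K) ζ) :=
    (IsUnit.of_pow_eq_one hζp hp.ne_zero).map _
  refine ⟨hζu.unit, rfl, Units.ext ?_, fun h ↦ hζ1 ?_, fun σ hσ ↦ ?_⟩
  · rw [Units.val_pow_eq_pow_val, IsUnit.unit_spec, ← map_pow, hζp, map_one, Units.val_one]
  · have h' := congrArg Units.val h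
    rw [IsUnit.unit_spec, Units.val_one, ← map_one (closureEmb (K := K) (v.adicCompletion K))] at h'
    exact (closureEmb (K := K) (v.adicCompletion K)).injective h'
  · rw [IsUnit.unit_spec, ← Field.absoluteGaloisGroup.smul_def, ← closureEmb_resGal_smul, hσ]

end Local

section Global

variable {K : Type} [Field K] [NumberField K] (W : WeierstrassCurve K) [W.IsElliptic]
  {v : HeightOneSpectrum (𝓞 K)}

/-- **E2 (PROVED here from E1, E1′ and IMPORTS 1, 5) — the GLOBAL Tate eigenline with a COMMON sign.**  At a multiplicative place `v`
there is ONE sign function `ε : Γ_{K_v} → {±1}` (the unramified quadratic twist of Silverman V.5.3,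
trivial iff split) such that for EVERY prime `p` and every non-trivial `p`-th root of unity `ζ ∈ K̄`,
some non-zero `P ∈ E[p](K̄)` satisfies `σ|_{K̄} • P = ε σ • P` for all `σ ∈ Γ_{K_v}` with `σ|_{K̄} ζ = ζ`.
Proof plan (pattern of PROVED `exists_unipotent_of_hasMultiplicativeReductionAt`): IMPORT 1 → `ε`;
E1′ → `u`; E1 → `L = Ψ(u)`; IMPORT 5 → global `P` with `pointsMap P = L`; `pointsMap_smul` +
`pointsMapOfEmb_injective` transport the eigen-relation.  No `hζ`, no `p ∤ v`, uniform in `char k_v`. -/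
theorem helper_tate_eigenline_global (hmult : W.HasMultiplicativeReductionAt v) :
    ∃ ε : absoluteGaloisGroup (v.adicCompletion K) → ℤ,
      (∀ σ, ε σ = 1 ∨ ε σ = -1) ∧
      ∀ (p : ℕ), p.Prime → ∀ ζ : AlgebraicClosure K, ζ ^ p = 1 → ζ ≠ 1 →
        ∃ P : geomPoints W, P ≠ 0 ∧ p • P = 0 ∧
          ∀ σ : absoluteGaloisGroup (v.adicCompletion K),
            resGal (K := K) (v.adicCompletion K) σ • ζ = ζ →
              resGal (K := K) (v.adicCompletion K) σ • P = ε σ • P := by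
  obtain ⟨q, t, Ψ, hq0, hq1, -, -, -, -, -, hker, htw⟩ :=
    TateCurve.exists_twistedTateUniformisation_tateJ W v hmult
  refine ⟨fun σ ↦ if Field.absoluteGaloisGroup.toAlgEquiv (v.adicCompletion K) σ t = t then (1 : ℤ)
      else -1, fun σ ↦ ?_, fun p hp ζ hζp hζ1 ↦ ?_⟩
  · by_cases h : Field.absoluteGaloisGroup.toAlgEquiv (v.adicCompletion K) σ t = t
    · exact Or.inl (if_pos h)
    · exact Or.inr (if_neg h)
  haveI : Fact p.Prime := ⟨hp⟩
  -- E1′: the unit `u = ι(ζ) ∈ K̄_vˣ`; E1: the eigenpoint `L = Ψ(u)`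
  obtain ⟨u, hu, hup, hu1, hufix⟩ := helper_unit_of_closureEmb (K := K) v hp hζp hζ1
  obtain ⟨hL0, hpL, hLσ⟩ := helper_tate_eigenpoint_local W v hq0 hq1 Ψ hker
    (fun σ ↦ if Field.absoluteGaloisGroup.toAlgEquiv (v.adicCompletion K) σ t = t then (1 : ℤ)
      else -1) htw hup hu1
  -- IMPORT 5: the eigenpoint comes from `E(K̄)`
  have hpL' : p • Ψ (Additive.ofMul u) = 0 := by rw [← natCast_zsmul]; exact hpL
  obtain ⟨P, hpP, hPL⟩ := exists_pointsMapOfEmb_eq_of_nsmul_eq_zero W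
    (closureEmb (K := K) (v.adicCompletion K)) hp.ne_zero hpL'
  have hinj : Function.Injective (pointsMap W (v.adicCompletion K)) := pointsMapOfEmb_injective W _
  refine ⟨P, ?_, hpP, fun σ hσ ↦ hinj ?_⟩
  · rintro rfl
    exact hL0 (by rw [← hPL, map_zero])
  · have key := hLσ σ (hufix σ hσ)
    rw [← hPL] at key
    rw [pointsMap_smul, map_zsmul]
    exact key

/-- **E3 (PROVED here, pure algebra) — the sign is read off at an ODD level.** If `ε ∈ {±1}`,
`P ≠ 0` is `p`-torsion with `p` odd and `ε • P = -P`, then `ε = -1`. (Used with `p = 5`.) -/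
theorem helper_sign_eq_neg_one {A : Type*} [AddCommGroup A] {P : A} (hP : P ≠ 0) {p : ℕ}
    (hp : Odd p) (hpP : p • P = 0) {ε : ℤ} (hε : ε = 1 ∨ ε = -1) (h : ε • P = -P) : ε = -1 := by
  rcases hε with rfl | rfl
  · exfalso
    rw [one_zsmul] at h
    have h2 : 2 • P = 0 := by rw [two_nsmul]; nth_rw 1 [h]; exact neg_add_cancel P
    have hd : addOrderOf P ∣ 1 := by
      have := Nat.dvd_gcd (addOrderOf_dvd_of_nsmul_eq_zero h2) (addOrderOf_dvd_of_nsmul_eq_zero hpP)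
      rwa [Nat.Coprime.gcd_eq_one (Nat.coprime_two_left.mpr hp)] at this
    exact hP (AddMonoid.addOrderOf_eq_one_iff.mp (Nat.dvd_one.mp hd))
  · rfl

/-- **E4 (PROVED here; pure import) — conjugating a decomposition-group element onto `Γ_{K_v}`.**  If `φ ∈ D_𝔓` for a
prime `𝔓` above `v`, then `φ = g · σ|_{K̄} · g⁻¹` for some `g ∈ Γ_K`, `σ ∈ Γ_{K_v}`
(IMPORT 4: `g • 𝔓₀ = 𝔓`; IMPORT 2: `D_{𝔓₀} = range resGal`; `MulAction.stabilizer_smul_eq_stabilizer_map_conj`). -/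
theorem helper_conj_resGal_of_mem_decompositionSubgroup {𝔓 : Ideal (absIntegers (𝓞 K) K)}
    (h𝔓 : 𝔓 ∈ v.primesAbove) {φ : absoluteGaloisGroup K}
    (hφ : φ ∈ 𝔓.decompositionSubgroup (absoluteGaloisGroup K)) :
    ∃ (g : absoluteGaloisGroup K) (σ : absoluteGaloisGroup (v.adicCompletion K)),
      φ = g * resGal (K := K) (v.adicCompletion K) σ * g⁻¹ := by
  obtain ⟨g, hg⟩ := HeightOneSpectrum.exists_smul_eq_of_mem_primesAbove_holds
    (adicCompletionPrime_mem_primesAbove K v) h𝔓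
  subst hg
  rw [Ideal.decompositionSubgroup_smul, Subgroup.mem_pointwise_smul_iff_inv_smul_mem,
    decompositionSubgroup_adicCompletionPrime_eq_range] at hφ
  obtain ⟨σ, hσ⟩ := MonoidHom.mem_range.mp hφ
  refine ⟨g, σ, ?_⟩
  rw [resGal_eq_absGaloisRestrict]
  change φ = g * (absGaloisRestrict K (v.adicCompletion K)).toMonoidHom σ * g⁻¹
  rw [hσ, MulAut.smul_def, MulAut.conj_inv_apply]
  group

/-- **E5 (PROVED here) — `χ̄_N(σ) = 1` means `σ` fixes the `N`-th roots of unity of `K̄`**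
(`modNCyclotomicCharacter_spec`).  Turns k2-g8's hypotheses `h3`/`h5` into the fixing hypotheses of E2,
conjugation-invariantly (`χ̄_N` is a homomorphism to an abelian group). -/
theorem helper_smul_eq_self_of_modNCyclotomicCharacter_eq_one {N : ℕ} [NeZero N]
    {σ : absoluteGaloisGroup K} (hσ : modNCyclotomicCharacter K N σ = 1) {ζ : AlgebraicClosure K}
    (hζ : ζ ^ N = 1) : σ • ζ = ζ := by
  have h := modNCyclotomicCharacter_spec K N σ ζ hζ
  rw [hσ, Units.val_one] at h
  rcases Nat.lt_or_ge 1 N with hN | hN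
  · haveI : Fact (1 < N) := ⟨hN⟩
    rwa [ZMod.val_one, pow_one] at h
  · have hN1 : N = 1 := le_antisymm hN (Nat.pos_of_ne_zero (NeZero.ne N))
    subst hN1
    rw [pow_one] at hζ
    rw [hζ, smul_one]

omit [NumberField K] [W.IsElliptic] in
/-- **E5′ (PROVED here) — `φ = -1` on `E[n]` is conjugation-invariant.** -/
theorem helper_neg_conj {n : ℤ} {φ g : absoluteGaloisGroup K}
    (hneg : ∀ P : W.geomTorsion n, φ • P = -P) (P : W.geomTorsion n) :
    (g⁻¹ * φ * g) • P = -P := by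
  rw [mul_smul, mul_smul, hneg, smul_neg, inv_smul_smul]

end Global

/-! ### (k1-g9 §2)  The road-facing outputs (currency of k2-g8 Piece C `SurjThreeOfCuspData`) -/

/-- **E6 = N1e (PROVED here from E2–E5; only E2 is open) — a `-1`-EIGENVECTOR of `Frob_q` on `E[3]`.**  `E/ℚ` multiplicative
at `v`, `φ` a Frobenius at `𝔓 ∣ v` with `χ̄₃(φ) = χ̄₅(φ) = 1` acting as `-1` on `E[5]` ⇒ some
`P ∈ E[3] ∖ 0` has `φ • P = -P`.  Assembly: IMPORT 3 + E4 (`φ = g σ|_{K̄} g⁻¹`), E5 (`σ|_{K̄}` fixes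
`ζ₃, ζ₅`), E2 at `p = 5` with E5′ + E3 (`ε σ = -1`), E2 at `p = 3` (`σ|_{K̄} • P₃ = -P₃`), `P := g • P₃`.
SAME hypotheses as k2-g8 T2; no `q`, valid also for `v ∣ 15`. -/
theorem helper_frob_neg_eigenvector_three (E : WeierstrassCurve ℚ) [E.IsElliptic]
    {v : HeightOneSpectrum (𝓞 ℚ)} (hmult : E.HasMultiplicativeReductionAt v)
    {𝔓 : Ideal (absIntegers (𝓞 ℚ) ℚ)} (h𝔓 : 𝔓 ∈ v.primesAbove) {φ : absoluteGaloisGroup ℚ}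
    (hφ : IsArithFrobAt (𝓞 ℚ) φ 𝔓) (h3 : modNCyclotomicCharacter ℚ 3 φ = 1)
    (h5 : modNCyclotomicCharacter ℚ 5 φ = 1) (hneg : ∀ P : E.geomTorsion 5, φ • P = -P) :
    ∃ P : E.geomTorsion 3, P ≠ 0 ∧ φ • P = -P := by
  haveI := h𝔓.1
  -- E4: `φ = g σ|_{K̄} g⁻¹`
  obtain ⟨g, σ, hφg⟩ :=
    helper_conj_resGal_of_mem_decompositionSubgroup (K := ℚ) h𝔓 hφ.mem_stabilizer
  have hφ' : resGal (K := ℚ) (v.adicCompletion ℚ) σ = g⁻¹ * φ * g := by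
    rw [hφg]; group
  -- E2: the global eigenline with its common sign `ε`
  obtain ⟨ε, hε, hline⟩ := helper_tate_eigenline_global E hmult
  -- E5: `σ|_{K̄}` fixes `ζ₃`, `ζ₅` (cyclotomic characters are conjugation-invariant)
  have hfix : ∀ (N : ℕ) [NeZero N], modNCyclotomicCharacter ℚ N φ = 1 →
      ∀ ζ : AlgebraicClosure ℚ, ζ ^ N = 1 → resGal (K := ℚ) (v.adicCompletion ℚ) σ • ζ = ζ := by
    intro N _ hN ζ hζ
    refine helper_smul_eq_self_of_modNCyclotomicCharacter_eq_one ?_ hζ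
    rw [hφ', map_mul, map_mul, hN, mul_one, map_inv, inv_mul_cancel]
  -- E5′: `g⁻¹ φ g = -1` on `E[5]`, read in `E(K̄)`
  have hconj : ∀ (P : geomPoints E) (hP : P ∈ E.geomTorsion 5), (g⁻¹ * φ * g) • P = -P :=
    fun P hP ↦ congrArg Subtype.val (helper_neg_conj E (g := g) hneg ⟨P, hP⟩)
  have hmem : ∀ (n : ℕ) (P : geomPoints E), n • P = 0 → P ∈ E.geomTorsion n := by
    intro n P h
    refine (Submodule.mem_torsionBy_iff _ _).mpr ?_
    change ((n : ℕ) : ℤ) • P = 0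
    rw [natCast_zsmul, h]
  -- level 5: the sign `ε σ = -1` (E3)
  obtain ⟨ζ₅, hζ₅⟩ := HasEnoughRootsOfUnity.prim (M := AlgebraicClosure ℚ) (n := 5)
  obtain ⟨P₅, hP₅0, h5P₅, hP₅⟩ :=
    hline 5 (by norm_num) ζ₅ hζ₅.pow_eq_one (hζ₅.ne_one (by norm_num))
  have hεσ : ε σ = -1 := by
    have h1 := hP₅ σ (hfix 5 h5 ζ₅ hζ₅.pow_eq_one)
    have h2 : resGal (K := ℚ) (v.adicCompletion ℚ) σ • P₅ = -P₅ := by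
      rw [hφ']; exact hconj P₅ (hmem 5 P₅ h5P₅)
    exact helper_sign_eq_neg_one hP₅0 ⟨2, by norm_num⟩ h5P₅ (hε σ) (h1.symm.trans h2)
  -- level 3: the `-1`-eigenvector, conjugated back by `g`
  obtain ⟨ζ₃, hζ₃⟩ := HasEnoughRootsOfUnity.prim (M := AlgebraicClosure ℚ) (n := 3)
  obtain ⟨P₃, hP₃0, h3P₃, hP₃⟩ :=
    hline 3 (by norm_num) ζ₃ hζ₃.pow_eq_one (hζ₃.ne_one (by norm_num))
  have h3' : (g⁻¹ * φ * g) • P₃ = -P₃ := by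
    rw [← hφ', hP₃ σ (hfix 3 h3 ζ₃ hζ₃.pow_eq_one), hεσ, neg_one_zsmul]
  refine ⟨⟨g • P₃, smul_mem_torsionBy g (hmem 3 P₃ h3P₃)⟩, fun h0 ↦ hP₃0 ?_, Subtype.ext ?_⟩
  · have h0' : g • P₃ = 0 := by simpa using congrArg Subtype.val h0
    exact (smul_eq_zero_iff_eq g).mp h0'
  · show φ • g • P₃ = -(g • P₃)
    have h4 := congrArg (g • ·) h3'
    simp only [smul_smul, smul_neg] at h4
    rwa [show g * (g⁻¹ * φ * g) = φ * g by group, mul_smul] at h4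

/-- **E7 = T2′ (PROVED here; IMPORTS 7–8) — Cayley–Hamilton closes k2-g8 T2 VERBATIM.**  A `-1`-eigenvector on `E[3]` plus
`det ρ̄₃(φ) = χ̄₃(φ) = 1` give `(φ + 1)² = 0` on `E[3]`: in the frame `exists_frame_galoisRepTorsion_rat`
(IMPORT 7 / `det Φ = χ̄`), apply IMPORT 8 to `-M` (`det (-M) = det M` for `2 × 2`).
Honours `Disproof.switch_false_without_det` (the determinant is used). -/
theorem helper_addOneSq_of_neg_eigenvector (E : WeierstrassCurve ℚ) [E.IsElliptic]
    {φ : absoluteGaloisGroup ℚ} (h3 : modNCyclotomicCharacter ℚ 3 φ = 1)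
    {P : E.geomTorsion 3} (hP : P ≠ 0) (hφP : φ • P = -P) :
    ∀ Q : E.geomTorsion 3, φ • (φ • Q + Q) + (φ • Q + Q) = 0 := by
  haveI : Fact (Nat.Prime 3) := ⟨by norm_num⟩
  obtain ⟨e, Φ, he, -, hdet, -⟩ := exists_frame_galoisRepTorsion_rat E 3
  set M : Matrix (Fin 2) (Fin 2) (ZMod 3) :=
    ((Φ (galoisRepTorsion E ((3 : ℕ) : ℤ) φ) : GL (Fin 2) (ZMod 3)) : Matrix (Fin 2) (Fin 2) (ZMod 3))
    with hM
  -- the frame: `e (φ • Q) = M e(Q)`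
  have hMv : ∀ Q : E.geomTorsion 3, e (φ • Q) = M *ᵥ e Q := fun Q ↦ by
    rw [← galoisRepTorsion_apply]; exact he _ Q
  -- `det M = χ̄₃(φ) = 1` (this is where the determinant is used: `Disproof.switch_false_without_det`)
  have hdetM : M.det = 1 := by
    have h := hdet φ
    rw [modPCyclotomicCharacterZMod_eq_modNCyclotomicCharacter, h3] at h
    rw [hM, ← Matrix.GeneralLinearGroup.val_det_apply, h, Units.val_one]
  -- the `-1`-eigenvector in coordinates
  have hc : M *ᵥ e P = -(e P) := by rw [← hMv, hφP, map_neg]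
  have hc0 : e P ≠ 0 := fun h ↦ hP (by simpa using congrArg e.symm h)
  have hunit : IsUnit (e P 0) ∨ IsUnit (e P 1) := by
    by_contra hcon
    simp only [not_or, isUnit_iff_ne_zero, ne_eq, not_not] at hcon
    apply hc0
    funext i
    fin_cases i
    · simpa using hcon.1
    · simpa using hcon.2
  -- Cayley–Hamilton for `-M` (IMPORT 8): `(-M - 1)² = 0`, i.e. `(M + 1)² = 0`
  have hneg : (-M) *ᵥ e P = e P := by rw [Matrix.neg_mulVec, hc, neg_neg]
  have hdet' : (-M).det = 1 := by
    rw [Matrix.det_fin_two] at hdetM ⊢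
    simp only [Matrix.neg_apply]
    linear_combination hdetM
  have hsq := mul_self_sub_one_eq_zero_of_mulVec_eq_of_det_eq_one (-M) (e P) hunit hneg hdet'
  have hsq' : (M + 1) * (M + 1) = 0 := by
    rw [show -M - 1 = -(M + 1) by abel, neg_mul_neg] at hsq
    exact hsq
  intro Q
  apply e.injective
  simp only [map_add, map_zero, hMv]
  have h : ((M + 1) * (M + 1)) *ᵥ e Q = 0 := by rw [hsq', Matrix.zero_mulVec]
  rwa [← Matrix.mulVec_mulVec, Matrix.add_mulVec, Matrix.one_mulVec, Matrix.add_mulVec,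
    Matrix.one_mulVec] at h

/-- **k2-g8 T2, DISCHARGED (sorry-free composition of E6 + E7)**: exactly the signature of
`StubSwitchK2G8.helper_frob_addOneSq_three`, so k2-g8's PROVED `surjThreeOfCuspData_of_helpers` is untouched and
its T1 (`helper_twistedTate_addOneSq_local`) is no longer needed. -/
theorem helper_frob_addOneSq_three' (E : WeierstrassCurve ℚ) [E.IsElliptic]
    {v : HeightOneSpectrum (𝓞 ℚ)} (hmult : E.HasMultiplicativeReductionAt v)
    {𝔓 : Ideal (absIntegers (𝓞 ℚ) ℚ)} (h𝔓 : 𝔓 ∈ v.primesAbove) {φ : absoluteGaloisGroup ℚ}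
    (hφ : IsArithFrobAt (𝓞 ℚ) φ 𝔓) (h3 : modNCyclotomicCharacter ℚ 3 φ = 1)
    (h5 : modNCyclotomicCharacter ℚ 5 φ = 1) (hneg : ∀ P : E.geomTorsion 5, φ • P = -P) :
    ∀ Q : E.geomTorsion 3, φ • (φ • Q + Q) + (φ • Q + Q) = 0 := by
  obtain ⟨P, hP, hφP⟩ := helper_frob_neg_eigenvector_three E hmult h𝔓 hφ h3 h5 hneg
  exact helper_addOneSq_of_neg_eigenvector E h3 hP hφP

end K1G9Verbatim

/-- **T2 holds** (k1 gen 9, `helper_frob_addOneSq_three'`). -/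
theorem t2Statement_holds : T2Statement := by
  intro E _ v hmult 𝔓 h𝔓 φ hφ h3 h5 hneg
  exact helper_frob_addOneSq_three' E hmult h𝔓 hφ h3 h5 hneg

/-- **PIECE C `SurjThreeOfCuspData` — PROVED (sorry-free, this file).** -/
theorem surjThreeOfCuspData : SurjThreeOfCuspData := surjThreeOfCuspData_of t2Statement_holds

/-! ## sanity: the tree inputs consumed above exist with the expected shape -/

example (E : WeierstrassCurve ℚ) [E.IsElliptic] {v : HeightOneSpectrum (𝓞 ℚ)}
    (hmult : E.HasMultiplicativeReductionAt v) (h3v : ((3 : ℕ) : 𝓞 ℚ) ∉ v.asIdeal)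
    (h5 : E.ordMinimalDiscriminant v = 5) :
    3 ∣ Nat.card (galoisRepTorsion E ((3 : ℕ) : ℤ)).range :=
  E.dvd_card_range_galoisRepTorsion_of_hasMultiplicativeReductionAt_of_not_dvd hmult Nat.prime_three
    h3v (by rw [h5]; decide)


end Summit.ABC.ABC.Cruxes.FreyModularity.StubSwitchK1G10

end
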